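import Literature.NumberTheory.LFunctions.Zhang2022.Section5Lemma57
import Literature.NumberTheory.LFunctions.Zhang2022.RepairBedScale
import HarnessLib

/-!
# Zhang (2022), rescue GAP/BED (D-0124 (3)(4)): the Lemma 5.7 passage («(A) ⟹ 𝔞 ≫ 1») consumes
# Assumption (A) only at strength `‖L(1,χ)‖ ≤ c/𝓛` — kernel twin of the «minimum premise» datum
# (bed-2 NODE2-STEP-LEDGER §6 «the 𝓛⁻²⁰²² of (A) is consumed elsewhere … Lemma 5.7»; GAP G-31 exponent layer)

Topic `Literature/NumberTheory/LFunctions/Zhang2022` (Landau–Siegel audit tree; verdict-neutral).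
Y. Zhang, *Discrete mean estimates and the Landau–Siegel zero*, arXiv:2211.02515v1 (2022)
[Zhang2022LandauSiegel] — **an unrefereed manuscript under adjudication; nothing in this file asserts or
denies its Theorems 1–2, and nothing here is a claim about Landau–Siegel zeros. The programme SEARCHES and
TYPES; no claim about Landau–Siegel zeros, Theorems 1–2 of arXiv:2211.02515 or a repaired Margin232 until a
kernel theorem says so.**

Lemma 5.7 (§5 p. 11: «`L′(1,χ) ≫ D/φ(D)`», whence §2's «(A) implies `𝔞 ≫ 1`», `𝔞` of (2.31) — the positive
factor multiplying every main term `𝔠ᵢ𝔞𝔓` of the node group (2.32)/(2.33)/(8.23)/(9.7)/(18.1)) is proved in the tree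
(`Lemma57.re_deriv_LFunction_one_ge`, `lemma_5_7_divisors`, `lemma_5_7`, `frakA_ge`) from the printed premise
`‖L(1,χ)‖ ≤ 𝓛⁻²⁰²²`. Its proof uses (A) at ONE place: the residue of the double pole carries the cross term
`u′(0)·L(1,χ)` with `|u′(0)| ≤ 4M_u𝓛` (Cauchy), which must be `o(1)` against the main term `e⁻¹∑_{n∣D} 1/n ≥ e⁻¹`.
So the passage consumes only `‖L(1,χ)‖ ≤ c/𝓛` for a suitable absolute `c` — (A)-exponent `E = 1` with a constant,
a fortiori every `E > 1` eventually. This file makes that a kernel fact, re-running the tree's proof with the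
(A)-line replaced by an explicit cross-term:

* `re_deriv_LFunction_one_ge_explicit` — for `χ` primitive quadratic mod `D`, `log D ≥ 3`, WITHOUT any hypothesis
  on `L(1,χ)`: `Re L′(1,χ) ≥ e⁻¹∑_{n∣D} 1/n − C₁·𝓛·‖L(1,χ)‖ − C₂·𝓛⁻²⁰¹¹` with the tree's absolute `C₁ = 4M_u`,
  `M_u = (13/4)⁴·2C_Γ·e`, and `C₂ = 2·18⁸·K₅₇·8·4028²⁰¹⁴` (the shifted-line term, `O(D^{−1/2}(1+𝓛)³)` in log currency);
* `lemma57_divisors_of_norm_le` — hence `Re L′(1,χ) ≥ (2e)⁻¹∑_{n∣D} 1/n` for `log D ≥ L₀` under the premise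
  **`‖L(1,χ)‖ ≤ c/log D`**, `c = (16 e M_u)⁻¹ > 0`; `lemma57_of_norm_le` (`≥ (4e)⁻¹ D/φ(D)`);
  `frakA_ge_of_norm_le` (`𝔞 ≥ 3/(2e²π²)` for the tree's `Lemma171.frakA`);
* `lemma57_divisors_of_assumptionAWith` — from `Repair.Bed.AssumptionAWith E D χ` for EVERY real exponent `E > 1`,
  for `log D ≥ L₀(E)` (the printed (A) is `E = 2022`).

So on the GAP's exponent axis the Lemma 5.7 door needs `E > 1` (indeed `E = 1` with the constant `c`), the Lemma 5.8
door `E ≥ 15` (`RepairGapLemma58Premise`), and the printed `E = 2022` is consumed only on Prop. 2.2's exceptional-set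
route (`Repair.Gap.ExpTuple.budgetS0_2000`). Theorems only; no definition, no named fact; nothing about (A) itself.

## References

* Y. Zhang, arXiv:2211.02515v1 (2022), §5 Lemma 5.7 (p. 11); §2 (2.31) and the sentence after it; Assumption (A) p. 4.
  [cite: Zhang2022LandauSiegel, §5, Lemma 5.7]
-/

noncomputable section

open Complex Filter Topology Set MeasureTheory Real Metric ArithmeticFunction

namespace Literature.NumberTheory.LFunctions.Zhang2022.Repair.Gap

open Literature.NumberTheory.LFunctions.DivisorSumCharSq (W)
open Literature.NumberTheory.LFunctions.Zhang2022.Lemma31 (ne_one_of_isPrimitive eight_lt_exp_three aux_logpow)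
open Literature.NumberTheory.LFunctions.ZetaM4 (CΓ CΓ_pos)
open Literature.NumberTheory.LFunctions.Zhang2022.Lemma57 (u1 F1 Kline57 Kline57_pos W_eq_residue_add re_W_nu_ge
  norm_deriv_u1_le norm_integral_F1_line_le one_le_sum_divisors half_self_div_totient_le_sum_divisors
  prod_one_add_inv_le_sum_divisors)
open Literature.NumberTheory.LFunctions.Zhang2022.Repair.Bed (AssumptionAWith)

/-! ## The explicit form of Lemma 5.7: no hypothesis on `L(1,χ)` -/

/-- **Lemma 5.7 with the (A)-dependence made explicit**: for `χ` primitive quadratic mod `D`, `log D ≥ 3`, and NO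
hypothesis on `L(1,χ)`:
`Re L′(1,χ) ≥ e⁻¹ ∑_{n∣D} 1/n − 4M_u·𝓛·‖L(1,χ)‖ − C₂·𝓛⁻²⁰¹¹`, `M_u = (13/4)⁴·2C_Γ·e`, `C₂ = 2·18⁸·K₅₇·8·4028²⁰¹⁴`
— the tree's proof of `Lemma57.re_deriv_LFunction_one_ge` verbatim (Mellin on `re z = 2`, shift to `re z = −1/4`
across the double pole, `Re W_ν(D⁴) ≥ e⁻¹∑_{n∣D}1/n`), keeping the cross term `‖u′(0)L(1,χ)‖ ≤ 4M_u𝓛‖L(1,χ)‖`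
instead of bounding it by (A). [cite: Zhang2022LandauSiegel, §5, Lemma 5.7] -/
theorem re_deriv_LFunction_one_ge_explicit {D : ℕ} [NeZero D] (χ : DirichletCharacter ℂ D)
    (hprim : χ.IsPrimitive) (hχ2 : χ ^ 2 = 1) (hL : 3 ≤ Real.log D) :
    Real.exp (-1) * ∑ n ∈ D.divisors, (1 : ℝ) / n
      - 4 * ((13 / 4 : ℝ) ^ 4 * (2 * CΓ) * Real.exp 1) * Real.log D * ‖χ.LFunction 1‖
      - 2 * 18 ^ 8 * Kline57 * (8 * 4028 ^ 2014) / Real.log D ^ 2011 ≤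
        (deriv χ.LFunction 1).re := by
  set M : ℝ := (4028 : ℝ) ^ 2014 with hM
  clear_value M
  set M' : ℝ := (18 : ℝ) ^ 8 with hM'
  clear_value M'
  set Mu : ℝ := (13 / 4 : ℝ) ^ 4 * (2 * CΓ) * Real.exp 1 with hMu
  set Lg : ℝ := Real.log D with hLdef
  have hL1 : 1 ≤ Lg := by linarith
  have hL0 : 0 < Lg := by linarith
  have hD0 : D ≠ 0 := by
    rintro rfl; simp [hLdef] at hL; linarith
  have hDpos : (0 : ℝ) < D := by exact_mod_cast Nat.pos_of_ne_zero hD0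
  have hD8 : 8 ≤ D := by
    have h1 : Real.exp 3 ≤ Real.exp Lg := Real.exp_le_exp.2 hL
    rw [hLdef, Real.exp_log hDpos] at h1
    have := eight_lt_exp_three
    exact_mod_cast (show (8 : ℝ) ≤ D by linarith)
  have hD1 : (1 : ℝ) ≤ D := by exact_mod_cast Nat.one_le_iff_ne_zero.2 hD0
  have hχ1 := ne_one_of_isPrimitive χ (by omega) hprim
  -- `X = D⁴`
  set X : ℝ := (D : ℝ) ^ 4 with hXdef
  have hXpos : 0 < X := by positivity
  have hX1 : 1 ≤ X := one_le_pow₀ hD1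
  have hXL : Real.log X ≤ 4 * Real.log D := by rw [hXdef, Real.log_pow]; push_cast; exact le_rfl
  have hDX : (D : ℝ) ≤ X := by
    calc (D : ℝ) = D ^ 1 := (pow_one _).symm
      _ ≤ D ^ 4 := pow_le_pow_right₀ hD1 (by norm_num)
  -- the explicit formula and the lower bound
  have hW := W_eq_residue_add χ hχ1 hXpos
  have hlow := re_W_nu_ge χ hχ2 hXpos hDX
  set Iline : ℂ := ∫ t : ℝ, F1 χ X ((((-(1 / 4) : ℝ)) : ℂ) + t * I) with hIline
  have hπ0 : (π : ℂ) ≠ 0 := ofReal_ne_zero.2 Real.pi_pos.ne'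
  have hWeq : W (fun n => divisorSumChar χ n) X =
      (deriv (u1 X) 0 * χ.LFunction 1 + deriv χ.LFunction 1) + (1 / (2 * π)) * Iline := by
    field_simp
    linear_combination hW
  -- the cross term `u′(0)·L(1,χ)`, kept explicit
  have hu := norm_deriv_u1_le (D := D) hL hX1 hXL
  rw [← hMu, ← hLdef] at hu
  have e1 : Mu / (1 / (4 * Lg)) = 4 * Mu * Lg := by field_simp
  rw [e1] at hu
  have hMu0 : 0 ≤ Mu := by rw [hMu]; have := CΓ_pos; positivity
  have hT1 : ‖deriv (u1 X) 0 * χ.LFunction 1‖ ≤ 4 * Mu * Lg * ‖χ.LFunction 1‖ := by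
    rw [norm_mul]
    exact mul_le_mul_of_nonneg_right hu (norm_nonneg _)
  -- the shifted line
  have hlp := aux_logpow (D := D) hL1 hDpos
  rw [← hLdef, ← hM] at hlp
  have hT2 : ‖(1 / (2 * (π : ℂ))) * Iline‖ ≤ 2 * M' * Kline57 * (8 * M) / Lg ^ 2011 := by
    rw [norm_mul]
    have hπ1 : ‖(1 / (2 * (π : ℂ)))‖ ≤ 1 := by
      rw [norm_div, norm_one, norm_mul, Complex.norm_ofNat, Complex.norm_real, Real.norm_eq_abs,
        abs_of_pos Real.pi_pos, div_le_one (by positivity)]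
      linarith [Real.pi_gt_three]
    have hI := norm_integral_F1_line_le χ hprim hD8 hXpos
    rw [← hIline, ← hM', ← hLdef] at hI
    set t : ℝ := (D : ℝ) ^ (1 / 8 : ℝ) with htdef
    have ht0 : 0 < t := by positivity
    have ht1 : 1 ≤ t := by rw [htdef]; exact Real.one_le_rpow hD1 (by norm_num)
    have ht4 : (D : ℝ) ^ (1 / 2 : ℝ) = t ^ 4 := by
      rw [htdef, ← Real.rpow_natCast, ← Real.rpow_mul hDpos.le]; norm_num
    have ht8 : (D : ℝ) = t ^ 8 := by
      rw [htdef, ← Real.rpow_natCast, ← Real.rpow_mul hDpos.le]; norm_num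
    have hX4 : X ^ (-(1 / 4) : ℝ) = 1 / t ^ 8 := by
      have e8 : (1 : ℝ) / t ^ 8 = t ^ (-(8 : ℝ)) := by
        rw [Real.rpow_neg ht0.le, ← Real.rpow_natCast t 8, one_div]; norm_num
      rw [e8, hXdef, ht8, ← pow_mul, ← Real.rpow_natCast, ← Real.rpow_mul ht0.le]
      norm_num
    rw [ht4] at hlp
    have hK := Kline57_pos
    have hM'0 : 0 ≤ M' := by rw [hM']; positivity
    have h8M : 0 ≤ 8 * M / Lg ^ 2011 := by rw [hM]; positivity
    have h1t : 1 / t ^ 3 ≤ 1 := by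
      rw [div_le_one (by positivity)]; exact one_le_pow₀ ht1
    have h23 : (1 + Lg) ^ 2 ≤ (1 + Lg) ^ 3 := pow_le_pow_right₀ (by linarith) (by norm_num)
    have hmain : Kline57 * (D : ℝ) ^ (1 / 8 : ℝ) * (1 + Lg) ^ 2 * X ^ (-(1 / 4) : ℝ) ≤
        Kline57 * (8 * M / Lg ^ 2011) := by
      calc Kline57 * (D : ℝ) ^ (1 / 8 : ℝ) * (1 + Lg) ^ 2 * X ^ (-(1 / 4) : ℝ)
          ≤ Kline57 * t * (1 + Lg) ^ 3 * (1 / t ^ 8) := by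
            rw [hX4, ← htdef]; gcongr
        _ = Kline57 * ((1 + Lg) ^ 3 / t ^ 4 * (1 / t ^ 3)) := by
            field_simp
        _ ≤ Kline57 * (8 * M / Lg ^ 2011 * 1) := by
            refine mul_le_mul_of_nonneg_left ?_ hK.le
            exact mul_le_mul hlp h1t (by positivity) h8M
        _ = Kline57 * (8 * M / Lg ^ 2011) := by ring
    calc ‖(1 / (2 * (π : ℂ)))‖ * ‖Iline‖
        ≤ 1 * (2 * M' * (Kline57 * (D : ℝ) ^ (1 / 8 : ℝ) * (1 + Lg) ^ 2 * X ^ (-(1 / 4) : ℝ))) :=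
          mul_le_mul hπ1 hI (norm_nonneg _) (by norm_num)
      _ ≤ 1 * (2 * M' * (Kline57 * (8 * M / Lg ^ 2011))) := by gcongr
      _ = 2 * M' * Kline57 * (8 * M) / Lg ^ 2011 := by ring
  -- combine: Re W = Re L′ + Re (u′(0)L(1,χ)) + Re ((1/2π)∫)
  have hre : (W (fun n => divisorSumChar χ n) X).re =
      (deriv χ.LFunction 1).re + (deriv (u1 X) 0 * χ.LFunction 1).re +
        ((1 / (2 * (π : ℂ))) * Iline).re := by
    rw [hWeq]; simp only [add_re]; ring
  have hb1 : (deriv (u1 X) 0 * χ.LFunction 1).re ≤ 4 * Mu * Lg * ‖χ.LFunction 1‖ :=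
    (Complex.re_le_norm _).trans hT1
  have hb2 : ((1 / (2 * (π : ℂ))) * Iline).re ≤ 2 * M' * Kline57 * (8 * M) / Lg ^ 2011 :=
    (Complex.re_le_norm _).trans hT2
  rw [hLdef] at hb1 hb2 ⊢
  linarith

/-! ## Lemma 5.7 from the minimum premise `‖L(1,χ)‖ ≤ c/log D` -/

/-- **Lemma 5.7 (divisor-sum form) from the premise `‖L(1,χ)‖ ≤ c/log D`**, `c = (16 e M_u)⁻¹`,
`M_u = (13/4)⁴·2C_Γ·e`: there is `L₀` such that for every `D` with `log D ≥ L₀` and every primitive quadratic `χ` mod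
`D` with `‖L(1,χ)‖ ≤ c/log D`, `Re L′(1,χ) ≥ (2e)⁻¹ ∑_{n∣D} 1/n`. The (A)-exponent this passage consumes is `1` (with a
constant), not `2022`. [cite: Zhang2022LandauSiegel, §5, Lemma 5.7] -/
theorem lemma57_divisors_of_norm_le : ∃ L₀ c : ℝ, 0 < c ∧ ∀ (D : ℕ) [NeZero D] (χ : DirichletCharacter ℂ D),
    χ.IsPrimitive → χ ^ 2 = 1 → L₀ ≤ Real.log D →
    ‖χ.LFunction 1‖ ≤ c / Real.log D →
      Real.exp (-1) / 2 * ∑ n ∈ D.divisors, (1 : ℝ) / n ≤ (deriv χ.LFunction 1).re := by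
  set Mu : ℝ := (13 / 4 : ℝ) ^ 4 * (2 * CΓ) * Real.exp 1 with hMu
  set C₂ : ℝ := 2 * 18 ^ 8 * Kline57 * (8 * 4028 ^ 2014) with hC₂
  have hMu0 : 0 < Mu := by rw [hMu]; have := CΓ_pos; positivity
  have hC₂0 : 0 < C₂ := by
    rw [hC₂]
    exact mul_pos (mul_pos (mul_pos two_pos (pow_pos (by norm_num) 8)) Kline57_pos)
      (mul_pos (by norm_num) (pow_pos (by norm_num) 2014))
  clear_value C₂
  have hMu' : Mu ≠ 0 := hMu0.ne'
  have hE := Real.exp_pos (1 : ℝ)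
  have hE1 : Real.exp (-1) * Real.exp 1 = 1 := by rw [← Real.exp_add]; norm_num
  -- `c = e⁻¹/(16 M_u)`: then `4 M_u 𝓛 · c/𝓛 = e⁻¹/4`
  refine ⟨max 3 (4 * C₂ * Real.exp 1), Real.exp (-1) / (16 * Mu), by positivity, ?_⟩
  intro D _ χ hprim hχ2 hL hA
  have hL3 : 3 ≤ Real.log D := le_trans (le_max_left _ _) hL
  have hLC : 4 * C₂ * Real.exp 1 ≤ Real.log D := le_trans (le_max_right _ _) hL
  have hD0 : D ≠ 0 := by
    rintro rfl; simp at hL3; linarith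
  have h := re_deriv_LFunction_one_ge_explicit χ hprim hχ2 hL3
  rw [← hMu, ← hC₂] at h
  have hS1 := one_le_sum_divisors (D := D) hD0
  set S : ℝ := ∑ n ∈ D.divisors, (1 : ℝ) / n
  set Lg : ℝ := Real.log D
  have hL1 : 1 ≤ Lg := by linarith
  have hL0 : 0 < Lg := by linarith
  have hLg' : Lg ≠ 0 := hL0.ne'
  have hq : 0 ≤ Real.exp (-1) := (Real.exp_pos _).le
  -- the cross term: `4 M_u 𝓛 ‖L(1,χ)‖ ≤ 4 M_u 𝓛 · c/𝓛 = e⁻¹/4`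
  have hcross : 4 * Mu * Lg * ‖χ.LFunction 1‖ ≤ Real.exp (-1) / 4 := by
    have h4 : 0 ≤ 4 * Mu * Lg := by positivity
    calc 4 * Mu * Lg * ‖χ.LFunction 1‖ ≤ 4 * Mu * Lg * (Real.exp (-1) / (16 * Mu) / Lg) :=
          mul_le_mul_of_nonneg_left hA h4
      _ = Real.exp (-1) / 4 := by field_simp; ring
  -- the line term: `C₂/𝓛^{2011} ≤ C₂/𝓛 ≤ e⁻¹/4`
  have hpow : Lg ≤ Lg ^ 2011 := by
    calc Lg = Lg ^ 1 := (pow_one _).symm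
      _ ≤ Lg ^ 2011 := pow_le_pow_right₀ hL1 (by norm_num)
  have hline : C₂ / Lg ^ 2011 ≤ Real.exp (-1) / 4 := by
    have h1 : C₂ / Lg ^ 2011 ≤ C₂ / Lg := div_le_div_of_nonneg_left hC₂0.le hL0 hpow
    refine h1.trans ?_
    rw [div_le_div_iff₀ hL0 (by norm_num)]
    have h2 : Real.exp (-1) * (4 * C₂ * Real.exp 1) = 4 * C₂ := by
      rw [show Real.exp (-1) * (4 * C₂ * Real.exp 1) = 4 * C₂ * (Real.exp (-1) * Real.exp 1) by ring,
        hE1, mul_one]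
    have h3 := mul_le_mul_of_nonneg_left hLC hq
    linarith
  nlinarith [mul_le_mul_of_nonneg_left hS1 hq]

/-- **Lemma 5.7 as printed from the premise `‖L(1,χ)‖ ≤ c/log D`**: there are `L₀` and `c > 0` with
`Re L′(1,χ) ≥ (4e)⁻¹·D/φ(D)` for every primitive quadratic `χ` mod `D`, `log D ≥ L₀`, `‖L(1,χ)‖ ≤ c/log D`.
[cite: Zhang2022LandauSiegel, §5, Lemma 5.7] -/
theorem lemma57_of_norm_le : ∃ L₀ c : ℝ, 0 < c ∧ ∀ (D : ℕ) [NeZero D] (χ : DirichletCharacter ℂ D),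
    χ.IsPrimitive → χ ^ 2 = 1 → L₀ ≤ Real.log D →
    ‖χ.LFunction 1‖ ≤ c / Real.log D →
      Real.exp (-1) / 4 * ((D : ℝ) / Nat.totient D) ≤ (deriv χ.LFunction 1).re := by
  obtain ⟨L₀, c, hc, hL₀⟩ := lemma57_divisors_of_norm_le
  refine ⟨max L₀ 1, c, hc, fun D _ χ hprim hχ2 hL hA => ?_⟩
  have hD0 : D ≠ 0 := by
    rintro rfl
    have : (1 : ℝ) ≤ Real.log ((0 : ℕ) : ℝ) := le_trans (le_max_right _ _) hL
    simp at this; linarith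
  have h := hL₀ D χ hprim hχ2 (le_trans (le_max_left _ _) hL) hA
  have harith := half_self_div_totient_le_sum_divisors (D := D) hD0
  have hq : 0 ≤ Real.exp (-1) := (Real.exp_pos _).le
  nlinarith

/-- **`𝔞 ≫ 1` from the premise `‖L(1,χ)‖ ≤ c/log D`** (the tree's `𝔞 = Lemma171.frakA χ` of (2.31)): there are
`L₀` and `c > 0` with `𝔞 ≥ 3/(2e²π²)` for every primitive quadratic `χ` mod `D`, `log D ≥ L₀`, `‖L(1,χ)‖ ≤ c/log D` —
the sentence «(A) implies 𝔞 ≫ 1 (see Lemma 5.7)» with (A) weakened to its `𝓛⁻¹` shadow.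
[cite: Zhang2022LandauSiegel, §2 (after (2.31)); §5, Lemma 5.7] -/
theorem frakA_ge_of_norm_le : ∃ L₀ c : ℝ, 0 < c ∧ ∀ (D : ℕ) [NeZero D] (χ : DirichletCharacter ℂ D),
    χ.IsPrimitive → χ ^ 2 = 1 → L₀ ≤ Real.log D →
    ‖χ.LFunction 1‖ ≤ c / Real.log D →
      3 / (2 * Real.exp 1 ^ 2 * π ^ 2) ≤ Lemma171.frakA χ := by
  obtain ⟨L₀, c, hc, hL₀⟩ := lemma57_divisors_of_norm_le
  refine ⟨max L₀ 1, c, hc, fun D _ χ hprim hχ2 hL hA => ?_⟩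
  have hD0 : D ≠ 0 := by
    rintro rfl
    have : (1 : ℝ) ≤ Real.log ((0 : ℕ) : ℝ) := le_trans (le_max_right _ _) hL
    simp at this; linarith
  have h := hL₀ D χ hprim hχ2 (le_trans (le_max_left _ _) hL) hA
  rw [Lemma171.frakA_def]
  set P : ℝ := ∏ p ∈ D.primeFactors, (1 + (1 : ℝ) / p) with hP
  have hP1 : 1 ≤ P := by
    rw [hP]
    exact Finset.one_le_prod fun p hp => by
      have : 0 ≤ (1 : ℝ) / p := by positivity
      linarith
  have hPS : P ≤ ∑ n ∈ D.divisors, (1 : ℝ) / n := prod_one_add_inv_le_sum_divisors hD0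
  have hprod : (∏ p ∈ D.primeFactors, ((p : ℝ) / (p + 1))) * P = 1 := by
    rw [hP, ← Finset.prod_mul_distrib]
    refine Finset.prod_eq_one fun p hp => ?_
    have hp0 : (p : ℝ) ≠ 0 := by exact_mod_cast (Nat.prime_of_mem_primeFactors hp).ne_zero
    have hp1 : (p : ℝ) + 1 ≠ 0 := by positivity
    field_simp
  have hprod' : ∏ p ∈ D.primeFactors, ((p : ℝ) / (p + 1)) = 1 / P :=
    eq_one_div_of_mul_eq_one_left hprod
  rw [hprod']
  set Lr : ℝ := (deriv χ.LFunction 1).re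
  have hP0 : 0 < P := by linarith
  have hq : 0 ≤ Real.exp (-1) / 2 := by positivity
  have hcP : Real.exp (-1) / 2 * P ≤ Lr :=
    le_trans (mul_le_mul_of_nonneg_left hPS hq) h
  have hcP0 : 0 ≤ Real.exp (-1) / 2 * P := by positivity
  have hE : Real.exp (-1) = (Real.exp 1)⁻¹ := Real.exp_neg 1
  have hE0 : 0 < Real.exp 1 := Real.exp_pos 1
  calc 3 / (2 * Real.exp 1 ^ 2 * π ^ 2) = 6 / π ^ 2 * (Real.exp (-1) / 2) ^ 2 * 1 := by
        rw [hE]; field_simp; ring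
    _ ≤ 6 / π ^ 2 * (Real.exp (-1) / 2) ^ 2 * P := by gcongr
    _ = 6 / π ^ 2 * (Real.exp (-1) / 2 * P) ^ 2 * (1 / P) := by
        field_simp
    _ ≤ 6 / π ^ 2 * Lr ^ 2 * (1 / P) := by gcongr

/-! ## The exponent form: every `E > 1` suffices -/

/-- **Lemma 5.7 (divisor-sum form) from Assumption (A) with ANY exponent `E > 1`** (`Repair.Bed.AssumptionAWith E D χ :
‖L(1,χ)‖ < (log D)^{−E}`; printed (A): `E = 2022`): there is `L₀ = L₀(E)` such that for `log D ≥ L₀` and `χ` primitive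
quadratic mod `D` with `AssumptionAWith E D χ`, `Re L′(1,χ) ≥ (2e)⁻¹∑_{n∣D} 1/n` (`(log D)^{−E} ≤ c/log D` once
`(log D)^{E−1} ≥ 1/c`). [cite: Zhang2022LandauSiegel, §5, Lemma 5.7] -/
theorem lemma57_divisors_of_assumptionAWith {E : ℝ} (hE : 1 < E) :
    ∃ L₀ : ℝ, ∀ (D : ℕ) [NeZero D] (χ : DirichletCharacter ℂ D),
    χ.IsPrimitive → χ ^ 2 = 1 → L₀ ≤ Real.log D → AssumptionAWith E D χ →
      Real.exp (-1) / 2 * ∑ n ∈ D.divisors, (1 : ℝ) / n ≤ (deriv χ.LFunction 1).re := by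
  obtain ⟨L₀, c, hc, hL₀⟩ := lemma57_divisors_of_norm_le
  -- `L₀' = max L₀ (max 1 ((1/c)^{1/(E−1)}))`: then `(log D)^{E−1} ≥ 1/c`
  refine ⟨max L₀ (max 1 ((1 / c) ^ (1 / (E - 1)))), fun D _ χ hprim hχ2 hL hA => ?_⟩
  have hL1 : 1 ≤ Real.log D := le_trans (le_trans (le_max_left _ _) (le_max_right _ _)) hL
  have hLr : (1 / c) ^ (1 / (E - 1)) ≤ Real.log D :=
    le_trans (le_trans (le_max_right _ _) (le_max_right _ _)) hL
  have hL0 : 0 < Real.log D := by linarith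
  refine hL₀ D χ hprim hχ2 (le_trans (le_max_left _ _) hL) ?_
  unfold AssumptionAWith at hA
  refine hA.le.trans ?_
  -- `1/(log D)^E ≤ c/log D  ⟺  (log D)^{E−1} ≥ 1/c`
  have hE1 : 0 < E - 1 := by linarith
  have hpow : 1 / c ≤ Real.log D ^ (E - 1) := by
    have h1 : (1 / c) ^ (1 / (E - 1)) ≥ 0 := by positivity
    have h2 : ((1 / c) ^ (1 / (E - 1))) ^ (E - 1) ≤ Real.log D ^ (E - 1) :=
      Real.rpow_le_rpow h1 hLr hE1.le
    rwa [← Real.rpow_mul (by positivity), one_div_mul_cancel hE1.ne', Real.rpow_one] at h2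
  have hsplit : Real.log D ^ E = Real.log D ^ (E - 1) * Real.log D := by
    rw [← Real.rpow_add_one hL0.ne', sub_add_cancel]
  have hpos : 0 < Real.log D ^ (E - 1) * Real.log D :=
    mul_pos (Real.rpow_pos_of_pos hL0 _) hL0
  rw [hsplit, div_le_div_iff₀ hpos hL0]
  -- `1 · log D ≤ c · ((log D)^{E−1} · log D)`
  have h1c : 1 ≤ c * Real.log D ^ (E - 1) := by
    have := mul_le_mul_of_nonneg_left hpow hc.le
    rwa [mul_one_div_cancel hc.ne'] at this
  nlinarith [mul_le_mul_of_nonneg_right h1c hL0.le]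

end Literature.NumberTheory.LFunctions.Zhang2022.Repair.Gap
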